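import Literature.IUT.HodgeArakelov.ThetaSettingDUUAutOfCyclicKernelAutAtModelTate
import Literature.IUT.HodgeArakelov.ThetaSettingModelTateExoticDatum
import Literature.AnabelianGeometry.EtaleTheta.SettingModelGfpLevelKernelRigidity
import HarnessLib

/-!
# ONE-LAW-NEG (A) «HTHETA-ADAMS-NEG»: a χ-compatible, `K_l`-moving, non-extendable automorphism of `Δ^tp_{X̲̲} = dUU l`
# — the sign partial Adams operation (proof-only; `hΘ_false_without_κ` ∧ `hextΔ_false_without_κ` at the Tate model)

S. Mochizuki, *The étale theta function …* [EtTh], Publ. RIMS **45** (2009), Cor. 2.18 (i) p. 60 (the clause (Θ)), Prop. 2.4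
p. 38 (extension of automorphisms of `Π^tp_{X̲̲}`), §1 pp. 12–14 (`Δ^Θ_X`, the coverings) [cite: MochizukiEtTh2009, Cor 2.18(i) p.60];
R. C. Lyndon, P. E. Schupp, *Combinatorial Group Theory*, Ch. I Prop. 3.7 [cite: LyndonSchupp2001, Ch. I Prop. 3.7].
Cell `abc-iut`, K-L6 slice, row «ONE-LAW-NEG@modelTate» file A (abc-iut-L6-lead gen 8, §F v1.19er (B) GO 2026-08-27T07:10Z;
desk origin: abc-iut-L6-d6's Kurosh datum «partial Adams operations», this seat's (B2) memo §7), seat abc-iut-w5-d169 (gen 13).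
PROOF-ONLY: no definition, no instance, no new named fact.  Inputs BY NAME: file A0 `exists_closureAut_of_cyclicKernelAut` /
`exists_dUUAut_of_closureAut` / `twist_eta_bConj` / `hHat_powHat_x_eq_zero` / `mem_closure_eta_of_hHat_x_eq_zero`, abc-iut-L6-d2's
`powHat_inv`, abc-iut-w5-d024's `powHat_unique`, abc-iut-L2-t1's `twist`/`twistGfp`/`hHat_twist`, abc-iut-L6-t13's
`exists_monoidHom_levelHom_comp_eq` (odd level).

THE THEOREM `exists_continuousMulEquiv_dUU_adamsSign` (`l ≥ 3` odd).  The SIGN partial Adams operation — the Nielsen sign change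
`b ↦ b⁻¹` on the Schreier basis `{a^j b a^{-j}}_{j<l} ∪ {a^l}` of `Ker(Δ → ℤ/l)`, all other basis elements fixed (`e_0 = −1`, `e_j = 1`;
it preserves the degree and `z mod l`) — completes to a bi-continuous automorphism `Θ` of `dUU l ≤ Γ = F̂₂ ×_Ẑ ℤ` which
(i) preserves `pr₂`; (ii) COMMUTES with every cyclotomic twist `θ_φ × id`, `φ ∈ Aut Ẑ` — the χ-law of the pair formalism
(abc-iut-w5-d125 p503499) EXACTLY, since the `b`-conjugates are θ-eigen and `Θ`'s completion commutes with `Ẑ`-powers (hence with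
`actχq p i j σ` for every `σ` with `κ_p σ = 1`, by `actχq_apply`/`affTwist₃_inr`); (iii) MOVES the `Γ`-part of the theta kernel:
`γ₀ = η(b_0 b_1^{-2} b_2) ∈ ⋂_N Ker levelHom_N` but `levelHom_l(Θ γ₀) = (0,−2,0) ≠ 1`; (iv) is NOT the restriction of ANY continuous
endomorphism `Φ` of `Γ`: `Φ` descends to an endomorphism `ε` of `Heis(ℤ/l)` (L6-t13), `Θ` forces `ε(0,1,0) = (0,−1,0)` (from `b`) and
`ε(0,2,0) = (0,2,0)` (from `b_1 b_{l−1} ∈ dUU l`, fixed), whence `4 = 0` in `ℤ/l`.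
CELL READING (K-L6 hΘ / hextΔ, one-law table of §F v1.19er (B)): the χ-law ALONE forces neither `K_l`-preservation nor extendability —
`hΘ_false_without_κ` and `hextΔ_false_without_κ`; dual to file B («HEXT-KUMMER-NEG», the κ-compatible multitwist) and to p505997
(no law).  Any decider of `hΘ` or `hextΔ` at the model must USE the Kummer (κ) law.
HONEST LABEL.  Statements about OUR semi-synthetic model of the typed [EtTh] §1 interface (not the tempered `π₁` of a curve) and the
geometric shadow of OUR typed binders; `hΘ`, `hextΔ` themselves (which quantify over `Aut_top(dUU l ⋊ G_{ℚ_p})` with BOTH laws) are NOT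
decided here; nothing of [EtTh] (refereed) or [IUTchII] (claim key `Mochizuki2012`, DISPUTED, D-0012) is asserted; no side is taken on
[IUTchIII] Cor. 3.12; typed ≠ proved; nothing here says abc is proved or refuted.
bears_on: LADDER-ABC:A2.L-K (K-L6 «ONE-LAW-NEG@modelTate») → LADDER-FRONTIER F-A2 (M·L6) → rung 0 `Summit.ABC`.
-/

set_option autoImplicit false

noncomputable section

namespace Literature.AnabelianGeometry.EtaleTheta.SettingModel

open Literature.AnabelianGeometry.SemiGraphs Literature.GroupTheory.CombinatorialGroupTheory
open Multiplicative

/-- **The SIGN partial Adams operation on `Δ^tp_{X̲̲} = dUU l`: χ-compatible, `K_l`-MOVING, NOT extendable to `Γ`.**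
(`l ≥ 3` odd.)  There is a bi-continuous automorphism `Θ` of the topological group `dUU l ≤ Γ = F̂₂ ×_Ẑ ℤ` (the completion of
the Nielsen sign change `b ↦ b⁻¹` on the Schreier basis `{a^j b a^{-j}}_{j<l} ∪ {a^l}` of `Ker(Δ → ℤ/l)`, all other basis
elements fixed) which (i) preserves the degree `pr₂`; (ii) COMMUTES with every cyclotomic twist `θ_φ × id`, `φ ∈ Aut Ẑ`
(the χ-law of the pair formalism, exactly); (iii) MOVES the `Γ`-part of the theta kernel: some `γ₀ ∈ ⋂_N Ker levelHom_N`
has `levelHom_l (Θ γ₀) ≠ 1`; (iv) is NOT the restriction of ANY continuous endomorphism of `Γ`.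
[cite: MochizukiEtTh2009, Cor 2.18(i) p.60] -/
theorem exists_continuousMulEquiv_dUU_adamsSign (l : ℕ+) (hl : 3 ≤ (l : ℕ)) (hodd : Odd (l : ℕ)) :
    ∃ Θ : ↥(dUU l) ≃ₜ* ↥(dUU l),
      (∀ γ : ↥(dUU l), gfpSnd ((Θ γ : ↥(dUU l)) : Gfp) = gfpSnd (γ : Gfp)) ∧
      (∀ (φ : MulAut ZH) (γ : ↥(dUU l)) (h : twistGfp φ (γ : Gfp) ∈ dUU l),
        ((Θ ⟨_, h⟩ : ↥(dUU l)) : Gfp) = twistGfp φ ((Θ γ : ↥(dUU l)) : Gfp)) ∧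
      (∃ γ₀ : ↥(dUU l), (∀ N : ℕ+, levelHom N (γ₀ : Gfp) = 1) ∧ levelHom l ((Θ γ₀ : ↥(dUU l)) : Gfp) ≠ 1) ∧
      (∀ Φ : Gfp →ₜ* Gfp, ∃ γ : ↥(dUU l), Φ (γ : Gfp) ≠ ((Θ γ : ↥(dUU l)) : Gfp)) := by
  classical
  haveI : NeZero (l : ℕ) := ⟨l.ne_zero⟩
  haveI : Fact (1 < (l : ℕ)) := ⟨by omega⟩
  -- §1 the discrete sign change on the Schreier basis
  let χ₀ : F₂ →* Multiplicative (ZMod l) :=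
    FreeGroup.lift fun i : Fin 2 => if i = 0 then ofAdd (1 : ZMod l) else 1
  have hχ₀ : ∀ i, χ₀ (FreeGroup.of i) = if i = 0 then ofAdd (1 : ZMod l) else 1 := fun i => FreeGroup.lift_apply_of
  let U : Subgroup Del := (χ₀.comp Del.val).ker
  let eD : Del ≃* F₂ := MulEquiv.ofBijective Del.val Del.val_bijective
  let bD : FreeGroupBasis (Fin 2) Del := FreeGroupBasis.ofRepr eD
  have hbD : ∀ i, Del.val (bD i) = FreeGroup.of i := fun i => eD.apply_symm_apply (FreeGroup.of i)
  have hχ : ∀ x, (χ₀.comp Del.val) (bD x) = if x = 0 then ofAdd (1 : ZMod l) else 1 := fun x => by rw [MonoidHom.comp_apply, hbD, hχ₀]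
  obtain ⟨bK, hbKl, hbKr⟩ := FreeGroupBasis.exists_freeGroupBasis_cyclicKernel bD (0 : Fin 2) l (χ₀.comp Del.val) hχ
  let β : {x : Fin 2 // x ≠ 0} := ⟨1, one_ne_zero⟩
  have hβ : ∀ x : {x : Fin 2 // x ≠ 0}, x = β := fun x => by
    rcases x with ⟨x, hx⟩; refine Subtype.ext ?_; fin_cases x <;> first | exact absurd rfl hx | rfl
  let I : Type := ({x : Fin 2 // x ≠ 0} × ZMod l) ⊕ Unit
  let f : I → FreeGroup I := fun i =>
    match i with
    | Sum.inl (x, a) => if a = 0 then (FreeGroup.of (Sum.inl (x, a)))⁻¹ else FreeGroup.of (Sum.inl (x, a))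
    | Sum.inr u => FreeGroup.of (Sum.inr u)
  let sF : FreeGroup I →* FreeGroup I := FreeGroup.lift f
  have hsF_inl : ∀ (x : {x : Fin 2 // x ≠ 0}) (a : ZMod l), sF (FreeGroup.of (Sum.inl (x, a))) =
      if a = 0 then (FreeGroup.of (Sum.inl (x, a)))⁻¹ else FreeGroup.of (Sum.inl (x, a)) := fun x a => FreeGroup.lift_apply_of
  have hsF_inr : sF (FreeGroup.of (Sum.inr ())) = FreeGroup.of (Sum.inr ()) := FreeGroup.lift_apply_of
  have hss : sF.comp sF = MonoidHom.id _ := by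
    refine FreeGroup.ext_hom _ _ fun i => ?_
    rw [MonoidHom.comp_apply, MonoidHom.id_apply]
    rcases i with ⟨x, a⟩ | ⟨⟩
    · rw [hsF_inl]
      by_cases ha : a = 0
      · rw [if_pos ha, map_inv, hsF_inl, if_pos ha, inv_inv]
      · rw [if_neg ha, hsF_inl, if_neg ha]
    · rw [hsF_inr, hsF_inr]
  let sE : FreeGroup I ≃* FreeGroup I := MonoidHom.toMulEquiv sF sF hss hss
  let σ₀ : U ≃* U := bK.repr.trans (sE.trans bK.repr.symm)
  have hb : ∀ i, bK.repr.symm (FreeGroup.of i) = bK i := fun i => rfl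
  have hσ : ∀ i, σ₀ (bK i) = bK.repr.symm (sF (FreeGroup.of i)) := fun i => by
    change bK.repr.symm (sF (bK.repr (bK i))) = _; rw [FreeGroupBasis.repr_apply_coe]
  have hσ0 : ∀ x : {x : Fin 2 // x ≠ 0}, σ₀ (bK (Sum.inl (x, 0))) = (bK (Sum.inl (x, 0)))⁻¹ := fun x => by
    rw [hσ, hsF_inl, if_pos rfl, map_inv, hb]
  have hσne : ∀ (x : {x : Fin 2 // x ≠ 0}) (a : ZMod l), a ≠ 0 → σ₀ (bK (Sum.inl (x, a))) = bK (Sum.inl (x, a)) :=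
    fun x a ha => by rw [hσ, hsF_inl, if_neg ha, hb]
  have hσA : σ₀ (bK (Sum.inr ())) = bK (Sum.inr ()) := by rw [hσ, hsF_inr, hb]
  -- values in `F₂`
  have hval : ∀ k : ℕ, k < (l : ℕ) → ((k : ZMod l)).val = k := fun k hk => by rw [ZMod.val_natCast, Nat.mod_eq_of_lt hk]
  have hvK' : ∀ a : ZMod l, Del.val ((bK (Sum.inl (β, a))) : Del) =
      FreeGroup.of 0 ^ a.val * FreeGroup.of 1 * (FreeGroup.of 0 ^ a.val)⁻¹ := fun a => by
    rw [hbKl, map_mul, map_mul, map_inv, map_pow, hbD, hbD]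
  have hvK : ∀ k : ℕ, k < (l : ℕ) → Del.val ((bK (Sum.inl (β, (k : ZMod l))) : Del)) =
      FreeGroup.of 0 ^ k * FreeGroup.of 1 * (FreeGroup.of 0 ^ k)⁻¹ := fun k hk => by rw [hvK', hval k hk]
  have hvA : Del.val ((bK (Sum.inr ())) : Del) = FreeGroup.of 0 ^ (l : ℕ) := by rw [hbKr, map_pow, hbD]
  have hv0 : Del.val ((bK (Sum.inl (β, 0))) : Del) = FreeGroup.of 1 := by
    have := hvK 0 (by omega); rw [Nat.cast_zero] at this; rw [this, pow_zero, one_mul, inv_one, mul_one]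
  have hK : ∀ k : ℕ, k < (l : ℕ) → heisHom (Del.val ((bK (Sum.inl (β, (k : ZMod l))) : Del))) = ⟨0, 1, (k : ℤ)⟩ :=
    fun k hk => by rw [hvK k hk, heisHom_conj_pow]
  -- (i) degree and (ii) `z mod l` are preserved (basis check)
  have hdeg : ∀ u : U, expA (Del.val ((σ₀ u : U) : Del)) = expA (Del.val (u : Del)) := by
    have key : (expA.comp (Del.val.comp U.subtype)).comp σ₀.toMonoidHom = expA.comp (Del.val.comp U.subtype) := by
      refine bK.ext_hom _ _ fun i => ?_
      rw [MonoidHom.comp_apply, MulEquiv.coe_toMonoidHom]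
      rcases i with ⟨x, a⟩ | ⟨⟩
      · by_cases ha : a = 0
        · subst ha; obtain rfl := hβ x
          change expA (Del.val ((σ₀ (bK (Sum.inl (β, 0))) : U) : Del)) = expA (Del.val ((bK (Sum.inl (β, 0))) : Del))
          rw [hσ0, Subgroup.coe_inv, map_inv, map_inv, hv0, expA_apply, heisHom_of_one]
          simp
        · rw [hσne x a ha]
      · rw [hσA]
    exact fun u => DFunLike.congr_fun key u
  have hmemU : ∀ d : Del, d ∈ U → (((heisHom (Del.val d)).x : ℤ) : ZMod l) = 0 := fun d hd => by
    have h := chi0_eq_heisHom_x l χ₀ hχ₀ (Del.val d)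
    rw [show χ₀ (Del.val d) = 1 from hd] at h
    simpa using congrArg toAdd h.symm
  have hzl : ∀ u : U, (((heisHom (Del.val ((σ₀ u : U) : Del))).z : ℤ) : ZMod l) =
      (((heisHom (Del.val (u : Del))).z : ℤ) : ZMod l) := by
    let zl : U →* Multiplicative (ZMod l) :=
      { toFun := fun u => ofAdd (((heisHom (Del.val (u : Del))).z : ZMod l))
        map_one' := by simp
        map_mul' := fun u v => by
          have hu : (((heisHom (Del.val (u : Del))).x : ℤ) : ZMod l) = 0 := hmemU _ u.2
          rw [← ofAdd_add, Subgroup.coe_mul, map_mul, map_mul, Heis.mul_z, Int.cast_add, Int.cast_add, Int.cast_mul,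
            hu, zero_mul, add_zero] }
    have hzl : ∀ u : U, zl u = ofAdd (((heisHom (Del.val (u : Del))).z : ZMod l)) := fun _ => rfl
    have key : zl.comp σ₀.toMonoidHom = zl := by
      refine bK.ext_hom _ _ fun i => ?_
      rw [MonoidHom.comp_apply, MulEquiv.coe_toMonoidHom]
      rcases i with ⟨x, a⟩ | ⟨⟩
      · by_cases ha : a = 0
        · subst ha; obtain rfl := hβ x
          rw [hσ0, map_inv, hzl (bK (Sum.inl (β, 0))), hv0, heisHom_of_one]
          simp
        · rw [hσne x a ha]
      · rw [hσA]
    intro u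
    have := DFunLike.congr_fun key u; rw [MonoidHom.comp_apply, MulEquiv.coe_toMonoidHom, hzl, hzl] at this
    exact ofAdd.injective this
  -- §2 transport (file A0, BY NAME)
  obtain ⟨W, Ψ, hmemW, heHat, hz, hΨη⟩ := exists_closureAut_of_cyclicKernelAut l χ₀ hχ₀ σ₀ hdeg hzl
  obtain ⟨Θ, hΘ⟩ := exists_dUUAut_of_closureAut l W Ψ hmemW heHat hz
  have hlev : ∀ (N : ℕ+) (γ : Gfp), levelHom N γ = hHat N ((γ : F₂hatT × Multiplicative ℤ).1) := fun _ _ => rfl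
  have hW_of : ∀ γ : ↥(dUU l), ((γ : Gfp) : F₂hatT × Multiplicative ℤ).1 ∈ W := fun γ => by
    rw [hmemW, ← hlev]
    exact ((mem_dUU_iff l (γ : Gfp)).mp γ.2).1
  have hηW : ∀ u : U, eta (Del.val (u : Del)) ∈ W := fun u => by
    rw [hmemW, hHat_eta, Heis.map_apply]
    change (Int.castRingHom (ZMod l)) (heisHom (Del.val (u : Del))).x = 0
    rw [eq_intCast]
    exact hmemU _ u.2
  have hΨcongr : ∀ (x y : F₂hatT) (hx : x ∈ W) (hy : y ∈ W), x = y → ((Ψ ⟨x, hx⟩ : W) : F₂hatT) = ((Ψ ⟨y, hy⟩ : W) : F₂hatT) :=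
    fun x y hx hy h => by subst h; rfl
  -- §3 the χ-law: `Ψ` commutes with every cyclotomic twist on `W`
  have htwW : ∀ (φ : MulAut ZH) {w : F₂hatT}, w ∈ W → twist φ w ∈ W := fun φ w hw => by
    rw [hmemW, hHat_twist, Heis.diagTwist_apply]
    exact (hmemW w).mp hw
  have hpowW : ∀ {w : F₂hatT}, w ∈ W → ∀ t : ZH, powHat w t ∈ W := fun hw t => by
    rw [hmemW]
    exact hHat_powHat_x_eq_zero l ((hmemW _).mp hw) t
  have hΨpow : ∀ (w : F₂hatT) (hw : w ∈ W) (t : ZH),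
      ((Ψ ⟨powHat w t, hpowW hw t⟩ : W) : F₂hatT) = powHat ((Ψ ⟨w, hw⟩ : W) : F₂hatT) t := by
    intro w hw t
    let P : ZH →* W := (powHat w).toMonoidHom.codRestrict W fun s => hpowW hw s
    let g : ZH →ₜ* F₂hatT :=
      ⟨(W.subtype.comp Ψ.toMonoidHom).comp P,
        by exact continuous_subtype_val.comp (Ψ.continuous.comp ((powHat w).continuous.subtype_mk _))⟩
    have hg : ∀ s, g s = ((Ψ ⟨powHat w s, hpowW hw s⟩ : W) : F₂hatT) := fun _ => rfl
    have h1 : g (iotaZ (ofAdd 1)) = ((Ψ ⟨w, hw⟩ : W) : F₂hatT) := by rw [hg]; exact hΨcongr _ _ _ _ (powHat_iotaZ_one w)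
    have hu := powHat_unique _ g h1
    rw [← hg, hu]
  have hkey : ∀ (φ : MulAut ZH) (w : F₂hatT) (hw : w ∈ W),
      ((Ψ ⟨twist φ w, htwW φ hw⟩ : W) : F₂hatT) = twist φ ((Ψ ⟨w, hw⟩ : W) : F₂hatT) := by
    intro φ
    -- the two continuous homomorphisms `W → F̂₂`
    let tW : W →* W := ((twist φ).toMonoidHom.comp W.subtype).codRestrict W fun w => htwW φ w.2
    let FL : W →* F₂hatT := (W.subtype.comp Ψ.toMonoidHom).comp tW
    let FR : W →* F₂hatT := (twist φ).toMonoidHom.comp (W.subtype.comp Ψ.toMonoidHom)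
    have hFL : ∀ w : W, FL w = ((Ψ ⟨twist φ (w : F₂hatT), htwW φ w.2⟩ : W) : F₂hatT) := fun _ => rfl
    have hFR : ∀ w : W, FR w = twist φ ((Ψ w : W) : F₂hatT) := fun _ => rfl
    have hFLc : Continuous FL :=
      continuous_subtype_val.comp (Ψ.continuous.comp (((twist φ).continuous.comp continuous_subtype_val).subtype_mk _))
    have hFRc : Continuous FR := (twist φ).continuous.comp (continuous_subtype_val.comp Ψ.continuous)
    -- the dense image of `U`
    let ιU : U →* W := (eta.comp (Del.val.comp U.subtype)).codRestrict W fun u => hηW u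
    have hιU : ∀ u : U, ((ιU u : W) : F₂hatT) = eta (Del.val (u : Del)) := fun _ => rfl
    have hdense : DenseRange ιU := by
      intro w
      rw [Topology.IsEmbedding.subtypeVal.closure_eq_preimage_closure_image, Set.mem_preimage]
      have himg : Subtype.val '' Set.range ιU = Set.range fun u : U => eta (Del.val (u : Del)) := by
        ext y
        constructor
        · rintro ⟨w', ⟨u, rfl⟩, rfl⟩
          exact ⟨u, rfl⟩
        · rintro ⟨u, rfl⟩
          exact ⟨ιU u, ⟨u, rfl⟩, rfl⟩
      rw [himg]
      exact mem_closure_eta_of_hHat_x_eq_zero l χ₀ hχ₀ ((hmemW _).mp w.2)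
    -- agreement on the Schreier generators
    set u := φ (iotaZ (ofAdd 1)) with hudef
    have hgen : FL.comp ιU = FR.comp ιU := by
      refine bK.ext_hom _ _ fun i => ?_
      change FL (ιU (bK i)) = FR (ιU (bK i))
      rw [hFL, hFR]
      rcases i with ⟨x, a⟩ | ⟨⟩
      · obtain rfl := hβ x
        have hw : eta (Del.val ((bK (Sum.inl (β, a))) : Del)) ∈ W := hηW _
        have htw : twist φ (eta (Del.val ((bK (Sum.inl (β, a))) : Del))) =
            powHat (eta (Del.val ((bK (Sum.inl (β, a))) : Del))) u := by
          rw [hvK', twist_eta_bConj]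
        have e1 : ((Ψ ⟨twist φ ((ιU (bK (Sum.inl (β, a))) : W) : F₂hatT), htwW φ (ιU _).2⟩ : W) : F₂hatT) =
            powHat ((Ψ ⟨_, hw⟩ : W) : F₂hatT) u := by
          rw [← hΨpow _ hw u]
          exact hΨcongr _ _ _ _ (by rw [hιU, htw])
        rw [e1]
        have e2 : ((Ψ (ιU (bK (Sum.inl (β, a)))) : W) : F₂hatT) = ((Ψ ⟨_, hw⟩ : W) : F₂hatT) := hΨcongr _ _ _ _ rfl
        rw [e2, hΨη _ hw]
        by_cases ha : a = 0
        · subst ha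
          rw [hσ0, Subgroup.coe_inv, map_inv, map_inv, powHat_inv, map_inv, htw]
        · rw [hσne β a ha, htw]
      · have hw : eta (Del.val ((bK (Sum.inr ())) : Del)) ∈ W := hηW _
        have hfix : twist φ (eta (Del.val ((bK (Sum.inr ())) : Del))) = eta (Del.val ((bK (Sum.inr ())) : Del)) := by
          rw [hvA, map_pow, map_pow, twist_eta_of_zero]
        have e1 : ((Ψ ⟨twist φ ((ιU (bK (Sum.inr ())) : W) : F₂hatT), htwW φ (ιU _).2⟩ : W) : F₂hatT) =
            ((Ψ ⟨_, hw⟩ : W) : F₂hatT) := hΨcongr _ _ _ _ (by rw [hιU, hfix])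
        have e2 : ((Ψ (ιU (bK (Sum.inr ()))) : W) : F₂hatT) = ((Ψ ⟨_, hw⟩ : W) : F₂hatT) := hΨcongr _ _ _ _ rfl
        rw [e1, e2, hΨη _ hw, hσA, hfix]
    have hall : (FL : W → F₂hatT) = FR := by
      refine hdense.equalizer hFLc hFRc ?_
      funext u'
      exact DFunLike.congr_fun hgen u'
    intro w hw
    have := congrFun hall ⟨w, hw⟩; rw [hFL, hFR] at this; exact this
  -- §4 the witnesses
  -- `γ₀ = η(b_0 b_1^{-2} b_2)` (in the theta kernel), `γ_b = η b`, `γ_c = η(b_1 b_{l-1})`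
  let n₀ : U := bK (Sum.inl (β, ((0 : ℕ) : ZMod l))) * (bK (Sum.inl (β, ((1 : ℕ) : ZMod l))) ^ 2)⁻¹ *
    bK (Sum.inl (β, ((2 : ℕ) : ZMod l)))
  have hn₀ : heisHom (Del.val (n₀ : Del)) = 1 := by
    change heisHom (Del.val ((bK (Sum.inl (β, ((0 : ℕ) : ZMod l))) *
      (bK (Sum.inl (β, ((1 : ℕ) : ZMod l))) ^ 2)⁻¹ * bK (Sum.inl (β, ((2 : ℕ) : ZMod l))) : U) : Del)) = 1
    simp only [Subgroup.coe_mul, Subgroup.coe_inv, Subgroup.coe_pow, map_mul, map_inv, map_pow]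
    rw [hK 0 (by omega), hK 1 (by omega), hK 2 (by omega), pow_two]
    ext <;> simp
  have h1ne : ((1 : ℕ) : ZMod l) ≠ 0 := by rw [Nat.cast_one]; exact one_ne_zero
  have h2ne : ((2 : ℕ) : ZMod l) ≠ 0 := by
    intro h
    have := congrArg ZMod.val h
    rw [hval 2 (by omega), ZMod.val_zero] at this
    omega
  have hσn₀ : heisHom (Del.val ((σ₀ n₀ : U) : Del)) = ⟨0, -2, 0⟩ := by
    change heisHom (Del.val ((σ₀ (bK (Sum.inl (β, ((0 : ℕ) : ZMod l))) *
      (bK (Sum.inl (β, ((1 : ℕ) : ZMod l))) ^ 2)⁻¹ * bK (Sum.inl (β, ((2 : ℕ) : ZMod l)))) : U) : Del)) = _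
    have h0 : σ₀ (bK (Sum.inl (β, ((0 : ℕ) : ZMod l)))) = (bK (Sum.inl (β, ((0 : ℕ) : ZMod l))))⁻¹ := by
      have := hσ0 β; rw [← Nat.cast_zero] at this; exact this
    rw [map_mul, map_mul, map_inv, map_pow, h0, hσne β _ h1ne, hσne β _ h2ne]
    simp only [Subgroup.coe_mul, Subgroup.coe_inv, Subgroup.coe_pow, map_mul, map_inv, map_pow]
    rw [hK 0 (by omega), hK 1 (by omega), hK 2 (by omega), pow_two]
    ext <;> simp
  -- the elements of `dUU l`
  have hGfp0 : ∀ u : U, expA (Del.val (u : Del)) = 1 →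
      ((eta (Del.val (u : Del)), (1 : Multiplicative ℤ)) : F₂hatT × Multiplicative ℤ) ∈ Gfp := fun u hu => by
    rw [mem_Gfp, eHat_eta, hu, map_one]
  have hdUU0 : ∀ (u : U) (hu : expA (Del.val (u : Del)) = 1), (heisHom (Del.val (u : Del))).x = 0 →
      (((heisHom (Del.val (u : Del))).z : ℤ) : ZMod l) = 0 → (⟨_, hGfp0 u hu⟩ : Gfp) ∈ dUU l := fun u hu hx hz0 => by
    rw [mem_dUU_iff, hlev]
    change (hHat l (eta (Del.val (u : Del)))).x = 0 ∧ (hHat l (eta (Del.val (u : Del)))).z = 0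
    rw [hHat_eta, Heis.map_apply]
    refine ⟨?_, ?_⟩
    · change (Int.castRingHom (ZMod l)) _ = 0; rw [eq_intCast, hx, Int.cast_zero]
    · change (Int.castRingHom (ZMod l)) _ = 0; rw [eq_intCast, hz0]
  have hlevΘ : ∀ (u : U) (hu : expA (Del.val (u : Del)) = 1) (hm : (⟨_, hGfp0 u hu⟩ : Gfp) ∈ dUU l) (N : ℕ+),
      levelHom N ((Θ ⟨_, hm⟩ : ↥(dUU l)) : Gfp) =
        Heis.map (Int.castRingHom (ZMod N)) (heisHom (Del.val ((σ₀ u : U) : Del))) := fun u hu hm N => by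
    rw [hlev, hΘ ⟨_, hm⟩ (hηW u)]
    change hHat N ((Ψ ⟨eta (Del.val (u : Del)), hηW u⟩ : W) : F₂hatT) = _
    rw [hΨη u (hηW u), hHat_eta]
  refine ⟨Θ, fun γ => ?_, fun φ γ h => ?_, ?_, fun Φ => ?_⟩
  · -- (i) degree
    rw [gfpSnd_apply, gfpSnd_apply, hΘ γ (hW_of γ)]
  · -- (ii) the χ-law
    refine Subtype.ext ?_
    rw [hΘ ⟨_, h⟩ (hW_of ⟨_, h⟩)]
    refine Prod.ext ?_ ?_
    · change ((Ψ ⟨twist φ ((γ : Gfp) : F₂hatT × Multiplicative ℤ).1, hW_of ⟨_, h⟩⟩ : W) : F₂hatT) =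
        twist φ (((Θ γ : ↥(dUU l)) : Gfp) : F₂hatT × Multiplicative ℤ).1
      rw [hΘ γ (hW_of γ)]
      exact hkey φ _ (hW_of γ)
    · change ((γ : Gfp) : F₂hatT × Multiplicative ℤ).2 = (((Θ γ : ↥(dUU l)) : Gfp) : F₂hatT × Multiplicative ℤ).2
      rw [hΘ γ (hW_of γ)]
  · -- (iii) moves `K_l`
    have hu : expA (Del.val (n₀ : Del)) = 1 := by rw [expA_apply, hn₀]; rfl
    have hm : (⟨_, hGfp0 n₀ hu⟩ : Gfp) ∈ dUU l :=
      hdUU0 n₀ hu (by rw [hn₀]; rfl) (by rw [hn₀, Heis.one_z, Int.cast_zero])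
    refine ⟨⟨_, hm⟩, fun N => ?_, ?_⟩
    · rw [hlev]
      change hHat N (eta (Del.val (n₀ : Del))) = 1
      rw [hHat_eta, hn₀, map_one]
    · rw [hlevΘ n₀ hu hm l, hσn₀, Heis.map_apply]
      intro h
      have hy := congrArg Heis.y h
      change (Int.castRingHom (ZMod l)) (-2) = (0 : ZMod l) at hy
      rw [map_neg, eq_intCast, Int.cast_ofNat, neg_eq_zero] at hy
      exact h2ne (by exact_mod_cast hy)
  · -- (iv) not extendable
    by_contra hall
    push Not at hall
    obtain ⟨ε, hε⟩ := exists_monoidHom_levelHom_comp_eq Φ l hodd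
    -- `γ_b = η b`: `Θ γ_b = η b⁻¹`
    let ub : U := bK (Sum.inl (β, 0))
    have hub : expA (Del.val (ub : Del)) = 1 := by
      change expA (Del.val ((bK (Sum.inl (β, 0))) : Del)) = 1
      rw [hv0, expA_apply, heisHom_of_one]; rfl
    have hvb : Del.val (ub : Del) = FreeGroup.of 1 := hv0
    have hmb : (⟨_, hGfp0 ub hub⟩ : Gfp) ∈ dUU l :=
      hdUU0 ub hub (by rw [hvb, heisHom_of_one]) (by rw [hvb, heisHom_of_one]; simp)
    have eb : ε ⟨0, 1, 0⟩ = ⟨0, -1, 0⟩ := by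
      have h1 := hε (⟨_, hGfp0 ub hub⟩ : Gfp)
      rw [hall ⟨_, hmb⟩, hlevΘ ub hub hmb l] at h1
      have hL : Heis.map (Int.castRingHom (ZMod l)) (heisHom (Del.val ((σ₀ ub : U) : Del))) = ⟨0, -1, 0⟩ := by
        change Heis.map _ (heisHom (Del.val ((σ₀ (bK (Sum.inl (β, 0))) : U) : Del))) = _
        rw [hσ0, Subgroup.coe_inv, map_inv, map_inv, hv0, heisHom_of_one]
        ext <;> simp
      have hR : levelHom l (⟨_, hGfp0 ub hub⟩ : Gfp) = ⟨0, 1, 0⟩ := by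
        rw [hlev]
        change hHat l (eta (Del.val (ub : Del))) = _
        rw [hvb, hHat_eta, heisHom_of_one]
        ext <;> simp
      rw [hL, hR] at h1
      exact h1.symm
    -- `γ_c = η(b_1 b_{l-1})`, fixed by `Θ`, with `levelHom_l = (0,2,0)`
    have hl1 : ((l : ℕ) - 1 : ℕ) < (l : ℕ) := by omega
    have hl1ne : (((l : ℕ) - 1 : ℕ) : ZMod l) ≠ 0 := by
      intro h
      have := congrArg ZMod.val h
      rw [hval _ hl1, ZMod.val_zero] at this
      omega
    let uc : U := bK (Sum.inl (β, ((1 : ℕ) : ZMod l))) * bK (Sum.inl (β, (((l : ℕ) - 1 : ℕ) : ZMod l)))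
    have hKc : heisHom (Del.val (uc : Del)) = ⟨0, 2, (l : ℤ)⟩ := by
      change heisHom (Del.val ((bK (Sum.inl (β, ((1 : ℕ) : ZMod l))) *
        bK (Sum.inl (β, (((l : ℕ) - 1 : ℕ) : ZMod l))) : U) : Del)) = _
      rw [Subgroup.coe_mul, map_mul, map_mul, hK 1 (by omega), hK _ hl1]
      ext <;> simp
    have hσc : σ₀ uc = uc := by
      change σ₀ (bK (Sum.inl (β, ((1 : ℕ) : ZMod l))) * bK (Sum.inl (β, (((l : ℕ) - 1 : ℕ) : ZMod l)))) = _
      rw [map_mul, hσne β _ h1ne, hσne β _ hl1ne]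
    have huc : expA (Del.val (uc : Del)) = 1 := by rw [expA_apply, hKc]; rfl
    have hmc : (⟨_, hGfp0 uc huc⟩ : Gfp) ∈ dUU l :=
      hdUU0 uc huc (by rw [hKc]) (by
        rw [hKc]; change (((l : ℕ) : ℤ) : ZMod l) = 0; rw [Int.cast_natCast, ZMod.natCast_self])
    have hcast : Heis.map (Int.castRingHom (ZMod l)) (⟨0, 2, (l : ℤ)⟩ : Heis ℤ) = ⟨0, 2, 0⟩ := by
      ext <;> simp
    have ec : ε ⟨0, 2, 0⟩ = ⟨0, 2, 0⟩ := by
      have h1 := hε (⟨_, hGfp0 uc huc⟩ : Gfp)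
      rw [hall ⟨_, hmc⟩, hlevΘ uc huc hmc l, hσc, hKc, hcast] at h1
      have hR : levelHom l (⟨_, hGfp0 uc huc⟩ : Gfp) = ⟨0, 2, 0⟩ := by
        rw [hlev]
        change hHat l (eta (Del.val (uc : Del))) = _
        rw [hHat_eta, hKc, hcast]
      rw [hR] at h1
      exact h1.symm
    -- but `(0,2,0) = (0,1,0)²`
    have hsq : (⟨0, 2, 0⟩ : Heis (ZMod l)) = ⟨0, 1, 0⟩ * ⟨0, 1, 0⟩ := by ext <;> norm_num
    rw [hsq, map_mul, eb] at ec
    have h4 := congrArg Heis.y ec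
    simp only [Heis.mul_y] at h4
    have h4' : (4 : ZMod l) = 0 := by linear_combination -h4
    have hdvd : (l : ℕ) ∣ 4 := by
      rw [← ZMod.natCast_eq_zero_iff]; exact_mod_cast h4'
    have hle : (l : ℕ) ≤ 4 := Nat.le_of_dvd (by norm_num) hdvd
    obtain ⟨m, hm⟩ := hodd
    have hl3 : (l : ℕ) = 3 := by omega
    rw [hl3] at hdvd
    exact absurd hdvd (by norm_num)

end Literature.AnabelianGeometry.EtaleTheta.SettingModel

end
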